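import Summits.AtomisticToContinuum.FouriersLaw.Theorems.HonestZwanzigRobinCoercivityLimitOperatorTransfer
import Summits.AtomisticToContinuum.FouriersLaw.Theorems.HonestZwanzigRobinCoercivitySymbolLowerBound
import Summits.AtomisticToContinuum.FouriersLaw.Theorems.HonestZwanzigRobinCoercivityCornerOfCrux

/-!
# `HonestZwanzig.RobinCoercivity`, line `limit-operator-memory-form` — modulo the rank-2 inputs, the crux IS (Q1) ∧ (Q2)

Support file for the crux `stmt-AtomisticToContinuum-12695` (`RobinCoercivity` of route `HonestZwanzig`, sub-problem
`FouriersLaw`). The line's four open inputs are the named Props of `…LimitOperatorTransfer`: (U′) `BlockBandDomination`, (L)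
`BlockBulkLimit`, (Q1) `BulkSymbolPositivity`, (Q2) `CornerCoercivity`. (U′), (L) and the flux-row bound `FluxRowBound` below
(N-uniform boundedness of the rows of `W_N(s)` against the flux direction `u = (1,…,1,−1)`: for bond rows these are the
orthogonal-dynamics DC responses `ρ_b(s)` plus single contact entries, for the contact rows the contact responses — the
boundedness clauses of the rank-2 crux `OrthogonalOhm`) are all of the rank-2 "locality / boundedness of the orthogonal current
memory" class. MODULO THEM the crux is EQUIVALENT to its two qualitative residues:

  `robinCoercivity_iff_residues : BlockBandDomination → BlockBulkLimit → FluxRowBound →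
      (RobinCoercivity ↔ (BulkSymbolPositivity ∧ CornerCoercivity))`

(⇐ is the transfer theorem `robinCoercivity_of_limitOperatorInputs`, p153458; ⇒ is the necessity of (Q1),
`symbol_ge_of_robinCoercivity` — every bulk limit has symbol `≥ c` — and `cornerCoercivity_of_robinCoercivity` — corner sections are
`⪰ c/4` for `N ≥ N₁(w)` from the crux on `Ran B = u^⊥` plus the flux-row bound.) Reading for the planners: beyond the locality debt it
shares with `OrthogonalOhm`, `RobinCoercivity` = [no exactly non-relaxing finite-wavelength energy pattern of the infinite chain] ∧
[no contact-trapped zero mode / a floor on the renormalised contact conductance].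
-/

noncomputable section

open MeasureTheory Finset Matrix Filter Topology
open Literature.MathematicalPhysics.KineticTheory.HeatConduction
open Summit.AtomisticToContinuum.FouriersLaw.Theses.HonestZwanzig

namespace Summit.AtomisticToContinuum.FouriersLaw.Theorems.HonestZwanzig.Robin

/-- **Flux-row bound** (rank-2 / `OrthogonalOhm` class, open): for `pinnedChain ω₂ lam β γ` (all `> 0`) and `T > 0` there is `C`
such that for every `N ≥ 2` and all small `s > 0`, every row of the block memory matrix satisfies `|(W_N(s)u)_i| ≤ C`,
`u_j = −1` at the right contact `j = N` and `+1` elsewhere (`u` spans `ker Bᵀ`). For a bond row `i = b+1` this is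
`|ρ_b(s) + W_{i,0} − W_{i,N}| ≤ C` with `ρ_b(s) = schur_s(j_b, J)` the orthogonal DC response of `OrthogonalOhm`. -/
def FluxRowBound : Prop :=
  ∀ ω₂ lam β γ : ℝ, 0 < ω₂ → 0 < lam → 0 < β → 0 < γ → ∀ T : ℝ, 0 < T → ∃ C : ℝ, ∀ N : ℕ, 2 ≤ N → ∃ s₀ : ℝ, 0 < s₀ ∧ ∀
    (lap : ℝ → (PhaseSpace N → ℝ) → (PhaseSpace N → ℝ) → ℝ) (e : Fin N → PhaseSpace N → ℝ) (G : ℝ → Matrix (Fin N)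
    (Fin N) ℝ) (schur : ℝ → (PhaseSpace N → ℝ) → (PhaseSpace N → ℝ) → ℝ) (g : Fin (N + 1) → PhaseSpace N → ℝ) (W : ℝ →
    Fin (N + 1) → Fin (N + 1) → ℝ), (∀ s f₁ f₂, lap s f₁ f₂ = ∫ t in Set.Ioi (0 : ℝ), Real.exp (-(s * t)) * ((∫ z, f₁
    z * (∫ y, f₂ y ∂((pinnedChain ω₂ lam β γ).transitionKernel N T T t.toNNReal z)) ∂(pinnedChain ω₂ lam β
    γ).gibbsMeasure N T) - (∫ z, f₁ z ∂(pinnedChain ω₂ lam β γ).gibbsMeasure N T) * (∫ z, f₂ z ∂(pinnedChain ω₂ lam β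
    γ).gibbsMeasure N T))) → (∀ x z, e x z = z.2 x ^ 2 / 2 + (pinnedChain ω₂ lam β γ).U (z.1 x) + ∑ j : Fin N, ((if
    j.val = x.val + 1 then (pinnedChain ω₂ lam β γ).V (z.1 j - z.1 x) / 2 else 0) + (if x.val = j.val + 1 then
    (pinnedChain ω₂ lam β γ).V (z.1 x - z.1 j) / 2 else 0))) → (∀ s, G s = Matrix.of fun x y => lap s (e x) (e y)) →
    (∀ s f₁ f₂, schur s f₁ f₂ = lap s f₁ f₂ - ∑ x, ∑ y, lap s f₁ (e x) * (G s)⁻¹ x y * lap s (e y) f₂) → (∀ i z, g i z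
    = (∑ b : Fin N, if b.val + 1 = i.val then (pinnedChain ω₂ lam β γ).bondCurrent N b z else 0) + (∑ x : Fin N, if
    (i.val = 0 ∧ x.val = 0) ∨ (i.val = N ∧ x.val + 1 = N) then (pinnedChain ω₂ lam β γ).γ * (T - z.2 x ^ 2) else 0)) →
    (∀ s i j, W s i j = (if i = j ∧ (i.val = 0 ∨ i.val = N) then (pinnedChain ω₂ lam β γ).γ * T ^ 2 else 0) - schur s
    (fun z => g i (z.1, -z.2)) (g j)) → ∀ s : ℝ, 0 < s → s < s₀ → ∀ i : Fin (N + 1), |∑ j : Fin (N + 1), W s i j * (if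
    j.val = N then -1 else 1)| ≤ C

/-- **Modulo the rank-2 inputs, `RobinCoercivity` ⟺ (Q1) ∧ (Q2).** -/
theorem robinCoercivity_iff_residues (hU : BlockBandDomination) (hL : BlockBulkLimit) (hF : FluxRowBound) :
    RobinCoercivity ↔ (BulkSymbolPositivity ∧ CornerCoercivity) := by
  refine ⟨fun hRC => ⟨?_, ?_⟩, fun h => robinCoercivity_of_limitOperatorInputs hU hL h.1 h.2⟩
  · -- (Q1) from the necessity link: every bulk limit has symbol ≥ c > 0
    intro ω₂ lam β γ hω hl hβ hγ T hT K hK hLK θ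
    obtain ⟨c, hc, h⟩ := symbol_ge_of_robinCoercivity hRC ω₂ lam β γ hω hl hβ hγ T hT
    exact lt_of_lt_of_le hc (h K hK hLK θ)
  · -- (Q2) from the corner link
    unfold FluxRowBound at hF
    exact cornerCoercivity_of_robinCoercivity hRC hF
 
end Summit.AtomisticToContinuum.FouriersLaw.Theorems.HonestZwanzig.Robin

end
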